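import Summits.CriticalPhenomena.PercolationContinuityZ3.Theorems.PercNearOneGluingNoHeavyQuantShapeForestTwoLo
import Summits.CriticalPhenomena.PercolationContinuityZ3.Theorems.PercNearOneGluingNoHeavyQuantLongTailTripleWide4Hub
import Summits.CriticalPhenomena.PercolationContinuityZ3.Theorems.PercNearOneGluingNoHeavyQuantPieceBlobLongHub
import HarnessLib

/-!
# QUANT lane R8, T-DEC: EVERY FOREST OF AT MOST THREE GLUED SIBLINGS `R^lo[q₁](R^K[g₁]) ⊔ R^lo[q₂](R^K[g₂]) ⊔ R^lo[q₃](R^K[g₃])` OF A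
# COMMON LONG-TAIL SHAPE `lo < K ≤ 4lo`, ANY PARAMETERS, IS SDEC AT EVERY TREE-OK FLOOR `x ≤ min qᵢgᵢ` — ORACLE-FREE (census-1 gen 34; the
# first long-tail FOREST theorem: extends census-1 g32's `sdec_shapeForests_all_twoLo`, which needed `K ≤ 2lo`, to `K ≤ 4lo` for widths `≤ 3`)

builds on p205010 (kernel theorem, internal audit signed; external expert review pending)

Support file (`--supports stmt-CriticalPhenomena-4575`), QUANT lane seat prim-quant-census-1 (gen 34); memo
`run/shared/lean/prim/quant/prim-quant-census-1/g34/FOREST3-G34.md`.  Theorems only (no definitions), standard axioms, no sorries.  It is the k-fold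
piece expansion of g31/g32 (`shapeForest_inv` / `shapeForest_inv_twoLo`, `…QuantShapeForest(TwoLo)`) run with the three LONG-TAIL ingredients landed by
census-1 g32/g33: the width-2 hub `sdec_sHub_two_all` (`…QuantLongTailPairHub`, g32) and the width-3 hub `sdec_sHub_three_upTo4` of EVERY shape
`lo < K ≤ 4lo` at EVERY gate `γ ≥ lo/K` (`sdec_sHub_twoThree_upTo4`, `…QuantLongTailTripleWide4Hub`, g33), and the far-giant piece beside a big blob
`sdec_pieceBlob_long` (`…QuantPieceBlobLongHub`, g33: every shape `lo < K ≤ 4lo`, every gate `γ ≥ lo/K`).  The forced mixture `gate_shapeSib_eq_mix`,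
`sdec_shapeSib`, `sdec_blob_step` (`…QuantShapeSibling`), `shapeForest_piece` / `shapeSibs_ftop_fmean` (`…QuantShapeForest`) and the tame-sibling
adjunction `sdec_append_tame` / `sdec_flaw_perm` (`…QuantResidueForestsAll`) are used verbatim.

WHAT IS NEW.  In the expansion of a forest of `k` glued siblings the hubs `sHub lo K P` that occur have width `|P| ≤ k` (the invariant below is
indexed by `|P| + |L| ≤ 3`), and the piece gates are `γ = (m − lo)/K ≥ lo/K` — for `K > 2lo` these may be `< 1/2`, which is exactly the regime of the
g32/g33 hubs and of `sdec_pieceBlob_long`.  So for `k ≤ 3` siblings every shape up to `K = 4lo` is covered: e.g. `R²(R⁵..R⁸)`, `R³(R⁷..R¹²)`,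
`R¹(R²..R⁴)` join g32's `K ≤ 2lo` list (there: every width).
* **`shapeSib_params_long`** — the parameter facts of a heavy glued sibling for EVERY shape `lo < K` (g31's `shapeSib_params` minus its `γ ≥ 1/2`).
* **`shapeForest_inv_long`** — the invariant of the piece expansion for `lo < K ≤ 4lo` on the states `|P| + |L| ≤ 3`
  (`sHub P ∗ flaw L` is a law / SDEC unless `|P| = 1 ∧ L = []` / `∗` big heavy blob SDEC).
* **`sdec_shapeForest_long`** — `lo < K ≤ 4lo`, `|L| ≤ 3` heavy glued siblings `⟨q,·,·,lo+K,S(g)⟩` (`q(lo+Kg) ≥ 2lo`, `x ≤ qg`), `0 < x` ⟹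
  `SDEC x (ftop L) (flaw L)`.
* **`sdec_shapeForest_long_append`** — the same forest with ANY number of light glued siblings of the shape (`q(lo+Kg) < 2lo`, tame) adjoined.
* **`sdec_shapeForests_three_long`** — THE HEADLINE: every forest of `≤ 3` glued siblings `R^lo(R^K)` of one shape `lo < K ≤ 4lo`, ANY parameters
  `0 < qᵢ, gᵢ < 1`, is SDEC at every floor `0 < x ≤ min qᵢgᵢ`.
Census-2 g80's `sdec_gluedThree_trueFloor` is the IDENTICAL-gate width-3 case for every shape; this file is the non-identical-gate theorem.

HONEST STATUS.  Widths `≥ 4` with `K > 2lo` stay open at the forest level (the hub of width `j ≥ 4` of a long-tail shape is kernel only for gates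
`≥ 1/2` and `2K ≤ lo·j`, `…QuantLongTailHubHalf`; the expansion produces gates down to `lo/K`); `K > 4lo` open at the hub level already.
`SiblingStep` (all tree-OK forests), `GluedDominatedMass`, `SDECConvClosed`, `FarTreeRow` OPEN; RATE class (log\*) / honest sentence of
`run/shared/lean/prim/quant/README.md` unchanged.  [this work].  Nothing here is cited as a published result.  The gluing rows served
[cite: KozmaNitzan2024, Conjecture 3 (p. 15)]; product measure [cite: Grimmett1999, §1.3 p. 10].
-/

noncomputable section

open scoped BigOperators

namespace Summit.CriticalPhenomena.PercolationContinuityZ3.Theorems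
namespace Quant
namespace LawDec

open Finset

/-- the point mass `δ_K` -/
local notation3 "δ[" K "]" => (fun k : ℕ => if k = (K : ℕ) then (1 : ℝ) else 0)

/-- the FAR-GIANT PIECE / sub-forest law of shape `(lo, K)`: `S(γ) = {lo: 1−γ, lo+K: γ}` -/
local notation3 "SP[" lo ", " K ", " a "]" => (fun h : ℕ => (1 - (a : ℝ)) * (if h = (lo : ℕ) then (1 : ℝ) else 0) +
  (a : ℝ) * (if h = (lo : ℕ) + (K : ℕ) then (1 : ℝ) else 0))

/-! ### Parameters of a heavy glued sibling, every shape -/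

/-- parameter facts of a glued sibling `R^lo[q](R^K[g])` with `lo < K` (ANY tail length) and `m = q(lo + Kg) ≥ 2lo`: `0 < B − m` (`B = lo+K`), the
mixture weight `α = B(1−q)/(B−m) ∈ [0,1]`, the blob gate `m/B ∈ [2lo/B, 1)` with `x ≤ m/B`, the piece gate `γ = (m−lo)/K` with `lo ≤ Kγ`, `γ < 1`,
`x·B ≤ lo + Kγ` (g31's `shapeSib_params` without its clause `γ ≥ 1/2`, the only one that used `K ≤ 2lo`). [this work] -/
theorem shapeSib_params_long (lo K : ℕ) (hloK : lo < K) {q g x : ℝ} (hq0 : 0 < q) (hq1 : q < 1) (hg1 : g < 1)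
    (hm : 2 * (lo : ℝ) ≤ q * ((lo : ℝ) + K * g)) (hx : x ≤ q * g) :
    0 < ((lo : ℝ) + K) - q * ((lo : ℝ) + K * g) ∧
      0 ≤ ((lo : ℝ) + K) * (1 - q) / (((lo : ℝ) + K) - q * ((lo : ℝ) + K * g)) ∧
      ((lo : ℝ) + K) * (1 - q) / (((lo : ℝ) + K) - q * ((lo : ℝ) + K * g)) ≤ 1 ∧
      2 * (lo : ℝ) ≤ ((lo : ℝ) + K) * (q * ((lo : ℝ) + K * g) / ((lo : ℝ) + K)) ∧
      q * ((lo : ℝ) + K * g) / ((lo : ℝ) + K) < 1 ∧ x ≤ q * ((lo : ℝ) + K * g) / ((lo : ℝ) + K) ∧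
      (lo : ℝ) ≤ K * ((q * ((lo : ℝ) + K * g) - lo) / K) ∧
      (q * ((lo : ℝ) + K * g) - lo) / K < 1 ∧ x * ((lo : ℝ) + K) ≤ lo + K * ((q * ((lo : ℝ) + K * g) - lo) / K) := by
  have hlo0 : (0 : ℝ) ≤ lo := Nat.cast_nonneg lo
  have hKR : (lo : ℝ) < K := by exact_mod_cast hloK
  have hK0 : (0 : ℝ) < K := by linarith
  have hB0 : (0 : ℝ) < (lo : ℝ) + K := by linarith
  set m : ℝ := q * ((lo : ℝ) + K * g) with hmdef
  have hKg : (K : ℝ) * g < K := by nlinarith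
  have hmq : m ≤ ((lo : ℝ) + K) * q := by rw [hmdef]; nlinarith
  have hBq : ((lo : ℝ) + K) * q < (lo : ℝ) + K := by nlinarith
  have hmB : m < (lo : ℝ) + K := lt_of_le_of_lt hmq hBq
  have hD : 0 < ((lo : ℝ) + K) - m := by linarith
  refine ⟨hD, div_nonneg (by nlinarith) hD.le, ?_, ?_, ?_, ?_, ?_, ?_, ?_⟩
  · rw [div_le_one hD]; nlinarith
  · rw [mul_div_cancel₀ _ hB0.ne']; exact hm
  · rw [div_lt_one hB0]; exact hmB
  · rw [le_div_iff₀ hB0]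
    have h1 : q * g * ((lo : ℝ) + K) ≤ m := by rw [hmdef]; nlinarith
    have h2 : x * ((lo : ℝ) + K) ≤ q * g * ((lo : ℝ) + K) := mul_le_mul_of_nonneg_right hx hB0.le
    linarith
  · rw [mul_div_cancel₀ _ hK0.ne']; linarith
  · rw [div_lt_one hK0]; linarith
  · rw [mul_div_cancel₀ _ hK0.ne']
    have : q * g * ((lo : ℝ) + K) ≤ m := by rw [hmdef]; nlinarith
    nlinarith

/-! ### The expansion for forests of at most three glued siblings of shape `(lo, K)`, `K ≤ 4lo` -/

/-- **THE INVARIANT** of the k-fold piece expansion for glued siblings of shape `(lo, K)` (`lo < K ≤ 4lo`) on the states `|P| + |L| ≤ 3`,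
`G = sHub P ∗ flaw L`: (1) law facts (mean `Σ_P (lo + Kγ) + fmean L`); (2) `G` SDEC unless `|P| = 1 ∧ L = []`; (3) `G ∗ gate δ_B(θ)` SDEC for every
big heavy blob `2lo ≤ Bθ`, `θ < 1`, `x ≤ θ` (`B = lo+K`).  Hubs of widths 2, 3 (`sdec_sHub_twoThree_upTo4`) and the long piece beside a blob
(`sdec_pieceBlob_long`) are the base; the width bound `|P| + |L| ≤ 3` is preserved by both recursive calls. [this work] -/
theorem shapeForest_inv_long (lo K : ℕ) (hloK : lo < K) (hK4 : K ≤ 4 * lo) {x : ℝ} (hx0 : 0 < x) (hx1 : x < 1) : ∀ L : List Sib,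
    (∀ s ∈ L, s.M = lo + K ∧ 0 < s.q ∧ s.q < 1 ∧ ∃ g : ℝ, 0 < g ∧ g < 1 ∧ s.ρ = SP[lo, K, g] ∧
      2 * (lo : ℝ) ≤ s.q * ((lo : ℝ) + K * g) ∧ x ≤ s.q * g) →
    ∀ P : List ℝ, (∀ γ ∈ P, (lo : ℝ) ≤ K * γ ∧ γ < 1 ∧ x * ((lo : ℝ) + K) ≤ lo + K * γ) → P.length + L.length ≤ 3 →
      ((∀ h, 0 ≤ lconv ((lo + K) * P.length) (ftop L) (sHub lo K P) (flaw L) h) ∧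
        (∀ h, (lo + K) * P.length + ftop L < h → lconv ((lo + K) * P.length) (ftop L) (sHub lo K P) (flaw L) h = 0) ∧
        ∑ h ∈ Finset.range ((lo + K) * P.length + ftop L + 1), lconv ((lo + K) * P.length) (ftop L) (sHub lo K P) (flaw L) h = 1 ∧
        ∑ h ∈ Finset.range ((lo + K) * P.length + ftop L + 1), (h : ℝ) * lconv ((lo + K) * P.length) (ftop L) (sHub lo K P) (flaw L) h
          = (P.map (fun γ => (lo : ℝ) + K * γ)).sum + fmean L) ∧
      ((P.length ≠ 1 ∨ L ≠ []) → SDEC x ((lo + K) * P.length + ftop L) (lconv ((lo + K) * P.length) (ftop L) (sHub lo K P) (flaw L))) ∧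
      (∀ θ : ℝ, 2 * (lo : ℝ) ≤ ((lo : ℝ) + K) * θ → θ < 1 → x ≤ θ →
        SDEC x ((lo + K) * P.length + ftop L + (lo + K))
          (lconv ((lo + K) * P.length + ftop L) (lo + K) (lconv ((lo + K) * P.length) (ftop L) (sHub lo K P) (flaw L)) (gate δ[lo + K] θ)))
  | [], _ => by
    intro P hP hlen
    have hlo : 1 ≤ lo := by omega
    have hloR : (1 : ℝ) ≤ lo := by exact_mod_cast hlo
    have hKR : (lo : ℝ) < K := by exact_mod_cast hloK
    have hK0 : (0 : ℝ) < K := by linarith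
    have hpos : ∀ γ ∈ P, 0 ≤ γ := fun γ h => by nlinarith [(hP γ h).1, hK0, hloR]
    have hP01 : ∀ γ ∈ P, 0 ≤ γ ∧ γ ≤ 1 := fun γ h => ⟨hpos γ h, (hP γ h).2.1.le⟩
    obtain ⟨a0, aM, a1, am⟩ := sHub_laws lo K P hP01
    have eG : lconv ((lo + K) * P.length) (ftop []) (sHub lo K P) (flaw []) = sHub lo K P := by
      funext h; exact lconv_delta_right _ _ _ aM h
    have eT : (lo + K) * P.length + ftop [] = (lo + K) * P.length := rfl
    rw [eG, eT]
    have hfm : fmean [] = 0 := rfl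
    rw [hfm, add_zero]
    have hlen' : P.length ≤ 3 := by simpa using hlen
    obtain ⟨hlo', _⟩ := shape_sum_bounds lo K x P (fun γ h => ⟨(hP γ h).2.1, (hP γ h).2.2⟩)
    have hta : x * (((lo + K) * P.length : ℕ) : ℝ) ≤ (P.map (fun γ => (lo : ℝ) + K * γ)).sum := by push_cast; linarith
    have c2 : (P.length ≠ 1 ∨ ([] : List Sib) ≠ []) → SDEC x ((lo + K) * P.length) (sHub lo K P) := by
      intro hc
      have hne : P.length ≠ 1 := hc.elim id (fun h => absurd rfl h)
      rcases Nat.lt_or_ge P.length 2 with hlt | hge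
      · have h0 : P.length = 0 := by omega
        rw [h0, Nat.mul_zero]
        intro q _ _ j' hj'
        omega
      · exact sdec_sHub_twoThree_upTo4 lo K hloK hK4 hx0 P (by omega) hP
    refine ⟨⟨a0, aM, a1, am⟩, c2, fun θ hθ hθ1 hxθ => ?_⟩
    by_cases h1 : P.length = 1
    · -- a lone far-giant piece beside a big heavy blob: `sdec_pieceBlob_long`
      obtain ⟨γ, rfl⟩ : ∃ γ, P = [γ] := by
        rcases P with _ | ⟨γ, _ | ⟨γ', P'⟩⟩
        · simp at h1
        · exact ⟨γ, rfl⟩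
        · simp at h1
      have hγ := hP γ (by simp)
      have cM : ∀ h, lo + K < h → SP[lo, K, γ] h = 0 := (sp_laws lo K (hpos γ (by simp)) hγ.2.1.le).2.1
      have e0 : sHub lo K [γ] = SP[lo, K, γ] := funext fun h => lconv_delta_left _ (lo + K) _ cM h
      have e1 : (lo + K) * [γ].length = lo + K := by simp
      rw [e1, e0, lconv_comm (lo + K) (lo + K), show lo + K + (lo + K) = 2 * lo + 2 * K by ring]
      exact sdec_pieceBlob_long lo K hloK hK4 hx0 hγ.1 hγ.2.1 (by linarith) hθ1 hθ hxθ hγ.2.2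
    · exact (sdec_blob_step (lo + K) hx0 hx1 hxθ hθ1.le a0 aM a1 am hta (c2 (Or.inl h1))).2.2.2.2
  | s :: L, hL => by
    intro P hP hlen
    have hlo : 1 ≤ lo := by omega
    have hK1 : 1 ≤ K := by omega
    have hloR : (1 : ℝ) ≤ lo := by exact_mod_cast hlo
    have hKR : (lo : ℝ) < K := by exact_mod_cast hloK
    have hB0 : (0 : ℝ) < (lo : ℝ) + K := by linarith
    have hK0 : (0 : ℝ) < K := by linarith
    have hlenL : P.length + L.length ≤ 3 := by simp only [List.length_cons] at hlen; omega
    have hlenQ : (P.length + 1) + L.length ≤ 3 := by simp only [List.length_cons] at hlen; omega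
    obtain ⟨hM, hq0, hq1, g, hg0, hg1, hρ, hm, hxg⟩ := hL s (by simp)
    have hL' : ∀ s' ∈ L, s'.M = lo + K ∧ 0 < s'.q ∧ s'.q < 1 ∧ ∃ g : ℝ, 0 < g ∧ g < 1 ∧ s'.ρ = SP[lo, K, g] ∧
        2 * (lo : ℝ) ≤ s'.q * ((lo : ℝ) + K * g) ∧ x ≤ s'.q * g := fun s' h' => hL s' (List.mem_cons_of_mem s h')
    obtain ⟨q, x₁, n, M, ρ⟩ := s
    simp only at hM hq0 hq1 hρ hm hxg
    subst hM
    subst hρ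
    -- parameters of the glued sibling
    set m : ℝ := q * ((lo : ℝ) + K * g) with hmdef
    set α : ℝ := ((lo : ℝ) + K) * (1 - q) / (((lo : ℝ) + K) - m) with hα
    set γ : ℝ := (m - lo) / K with hγ
    set θs : ℝ := m / ((lo : ℝ) + K) with hθs
    obtain ⟨_, hα0, hα1, hbigs, hθs1, hxθs, hloγ, hγ1, hxP⟩ := shapeSib_params_long lo K hloK hq0 hq1 hg1 hm hxg
    have hθs0 : 0 ≤ θs := le_trans hx0.le hxθs
    have hQ : ∀ γ' ∈ γ :: P, (lo : ℝ) ≤ K * γ' ∧ γ' < 1 ∧ x * ((lo : ℝ) + K) ≤ lo + K * γ' := by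
      intro γ' h'
      rcases List.mem_cons.1 h' with rfl | h'
      · exact ⟨hloγ, hγ1, hxP⟩
      · exact hP γ' h'
    obtain ⟨⟨a0, aM, a1, am⟩, _, a3⟩ := shapeForest_inv_long lo K hloK hK4 hx0 hx1 L hL' P hP hlenL
    obtain ⟨⟨b0, bM, b1, bm⟩, b2, _⟩ :=
      shapeForest_inv_long lo K hloK hK4 hx0 hx1 L hL' (γ :: P) hQ (by simpa only [List.length_cons] using hlenQ)
    obtain ⟨hft, hfm⟩ := shapeSibs_ftop_fmean lo K L hL'
    obtain ⟨hlo', _⟩ := shape_sum_bounds lo K x P (fun γ' h => ⟨(hP γ' h).2.1, (hP γ' h).2.2⟩)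
    set N : ℕ := (lo + K) * P.length + ftop L with hN
    set G : ℕ → ℝ := lconv ((lo + K) * P.length) (ftop L) (sHub lo K P) (flaw L) with hG
    set X₁ : ℕ → ℝ := lconv N (lo + K) G (gate δ[lo + K] θs) with hX₁
    set X₂ : ℕ → ℝ := lconv ((lo + K) * P.length + (lo + K)) (ftop L) (sHub lo K (γ :: P)) (flaw L) with hX₂
    have hsmean : Sib.mean ⟨q, x₁, n, lo + K, SP[lo, K, g]⟩ = (lo : ℝ) + K * g := (sp_laws lo K hg0.le hg1.le).2.2.2
    have eflaw : flaw (⟨q, x₁, n, lo + K, SP[lo, K, g]⟩ :: L) = lconv (ftop L) (lo + K) (flaw L) (gate SP[lo, K, g] q) := rfl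
    have eftop : ftop (⟨q, x₁, n, lo + K, SP[lo, K, g]⟩ :: L) = ftop L + (lo + K) := rfl
    have efmean : fmean (⟨q, x₁, n, lo + K, SP[lo, K, g]⟩ :: L) = fmean L + m := by
      show fmean L + q * Sib.mean ⟨q, x₁, n, lo + K, SP[lo, K, g]⟩ = _; rw [hsmean]
    rw [eflaw, eftop, efmean]
    simp only [List.length_cons] at b0 bM b1 bm b2
    rw [show (lo + K) * (P.length + 1) = (lo + K) * P.length + (lo + K) by ring] at b0 bM b1 bm b2
    rw [show (lo + K) * P.length + (lo + K) + ftop L = N + (lo + K) by rw [hN]; ring] at bM b1 bm b2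
    -- the mixture identity
    have hmix : ∀ h, lconv ((lo + K) * P.length) (ftop L + (lo + K)) (sHub lo K P) (lconv (ftop L) (lo + K) (flaw L) (gate SP[lo, K, g] q)) h
        = α * X₁ h + (1 - α) * X₂ h := by
      intro h
      rw [lconv_assoc, lconv_mix_right _ _ _ _ _ _ α (fun k => gate_shapeSib_eq_mix lo K hlo hK1 hq1 hg0.le hg1.le k) h, hX₁, hX₂,
        ← shapeForest_piece lo K P L γ]
    have eNt : (lo + K) * P.length + (ftop L + (lo + K)) = N + (lo + K) := by rw [hN]; ring
    rw [eNt]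
    -- laws of `X₁`
    obtain ⟨bl0, _, bl1, blm⟩ := gateBlob_laws (lo + K) hθs0 hθs1.le
    obtain ⟨c0, cM, c1, cm⟩ := lconv_laws a0 a1 am bl0 bl1 blm
    have hX₁s : SDEC x (N + (lo + K)) X₁ := a3 θs hbigs hθs1 hxθs
    have eθm : (((lo + K : ℕ)) : ℝ) * θs = m := by rw [hθs]; push_cast; field_simp
    have eγm : (lo : ℝ) + K * γ = m := by rw [hγ]; field_simp; ring
    have cm' : ∑ h ∈ Finset.range (N + (lo + K) + 1), (h : ℝ) * X₁ h = (P.map (fun γ => (lo : ℝ) + K * γ)).sum + (fmean L + m) := by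
      rw [hX₁, cm, eθm]; ring
    have bm' : ∑ h ∈ Finset.range (N + (lo + K) + 1), (h : ℝ) * X₂ h = (P.map (fun γ => (lo : ℝ) + K * γ)).sum + (fmean L + m) := by
      rw [hX₂, bm]; simp only [List.map_cons, List.sum_cons]; rw [eγm]; ring
    have main : ((∀ h, 0 ≤ lconv ((lo + K) * P.length) (ftop L + (lo + K)) (sHub lo K P) (lconv (ftop L) (lo + K) (flaw L) (gate SP[lo, K, g] q)) h) ∧
        (∀ h, N + (lo + K) < h →
          lconv ((lo + K) * P.length) (ftop L + (lo + K)) (sHub lo K P) (lconv (ftop L) (lo + K) (flaw L) (gate SP[lo, K, g] q)) h = 0) ∧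
        ∑ h ∈ Finset.range (N + (lo + K) + 1),
          lconv ((lo + K) * P.length) (ftop L + (lo + K)) (sHub lo K P) (lconv (ftop L) (lo + K) (flaw L) (gate SP[lo, K, g] q)) h = 1 ∧
        ∑ h ∈ Finset.range (N + (lo + K) + 1),
          (h : ℝ) * lconv ((lo + K) * P.length) (ftop L + (lo + K)) (sHub lo K P) (lconv (ftop L) (lo + K) (flaw L) (gate SP[lo, K, g] q)) h
          = (P.map (fun γ => (lo : ℝ) + K * γ)).sum + (fmean L + m)) ∧
        SDEC x (N + (lo + K)) (lconv ((lo + K) * P.length) (ftop L + (lo + K)) (sHub lo K P) (lconv (ftop L) (lo + K) (flaw L) (gate SP[lo, K, g] q))) := by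
      by_cases hcorner : P = [] ∧ L = []
      · -- one glued sibling alone
        obtain ⟨rfl, rfl⟩ := hcorner
        obtain ⟨t0, tM, t1, tm⟩ := shapeSib_laws lo K hq0.le hq1.le hg0.le hg1.le
        have e1 : lconv (ftop []) (lo + K) (flaw []) (gate SP[lo, K, g] q) = gate SP[lo, K, g] q := funext fun h => lconv_delta_left 0 _ _ tM h
        have eidx : ftop ([] : List Sib) + (lo + K) = lo + K := by show 0 + (lo + K) = lo + K; omega
        rw [eidx]
        have e2 : lconv ((lo + K) * ([] : List ℝ).length) (lo + K) (sHub lo K []) (gate SP[lo, K, g] q) = gate SP[lo, K, g] q :=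
          funext fun h => lconv_delta_left _ _ _ tM h
        have hN3 : N + (lo + K) = lo + K := by rw [hN]; simp [ftop]
        rw [e1, e2, hN3]
        refine ⟨⟨t0, tM, t1, by rw [tm, hmdef]; simp [fmean]⟩, sdec_shapeSib lo K hlo hK1 hx0 hq0 hq1 hg1 hxg⟩
      · have hcond : (γ :: P).length ≠ 1 ∨ L ≠ [] := by
          by_cases hPn : P = []
          · exact Or.inr (fun hLn => hcorner ⟨hPn, hLn⟩)
          · left; simp only [List.length_cons]; intro h; exact hPn (List.length_eq_zero_iff.1 (by omega))
        have hX₂s : SDEC x (N + (lo + K)) X₂ := b2 hcond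
        obtain ⟨r0, rM, r1, rm, rS⟩ := sdec_mix_laws hα0 hα1 hmix c0 cM c1 cm' b0 bM b1 bm' hX₁s hX₂s
        exact ⟨⟨r0, rM, r1, rm⟩, rS⟩
    obtain ⟨⟨r0, rM, r1, rm⟩, rS⟩ := main
    refine ⟨⟨r0, rM, r1, rm⟩, fun _ => rS, fun θ hθ hθ1 hxθ => ?_⟩
    have hta : x * ((N + (lo + K) : ℕ) : ℝ) ≤ (P.map (fun γ => (lo : ℝ) + K * γ)).sum + (fmean L + m) := by
      rw [hN]; push_cast
      have h1 : x * ((ftop L : ℕ) : ℝ) ≤ fmean L := hfm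
      have h2 : x * ((lo : ℝ) + K) ≤ m := by rw [← eγm]; exact hxP
      have e : x * (((lo : ℝ) + K) * (P.length : ℝ) + (ftop L : ℕ) + ((lo : ℝ) + K))
          = x * ((lo : ℝ) + K) * (P.length : ℝ) + x * ((ftop L : ℕ) : ℝ) + x * ((lo : ℝ) + K) := by ring
      rw [e]; linarith [hlo', h1, h2]
    exact (sdec_blob_step (lo + K) hx0 hx1 hxθ hθ1.le r0 rM r1 rm hta rS).2.2.2.2

/-- **EVERY FOREST OF AT MOST THREE GLUED SIBLINGS `R^lo[qᵢ](R^K[gᵢ])` OF A COMMON SHAPE `lo < K ≤ 4lo` IS SDEC AT EVERY FLOOR `x ≤ min qᵢgᵢ` —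
ORACLE-FREE**, in the far-giant regime `mᵢ = qᵢ(lo + Kgᵢ) ≥ 2lo` (every sibling heavy-unfloored).  The sibling data: `s = ⟨q, ·, ·, lo+K, S(g)⟩`,
`S(g) = {lo: 1−g, lo+K: g}` (`= slice δ_lo K g`, arm-1 g49's `gluedSib lo K q g ·`). [this work] -/
theorem sdec_shapeForest_long (lo K : ℕ) (hloK : lo < K) (hK4 : K ≤ 4 * lo) {x : ℝ} (hx0 : 0 < x) (L : List Sib) (hL3 : L.length ≤ 3)
    (hL : ∀ s ∈ L, s.M = lo + K ∧ 0 < s.q ∧ s.q < 1 ∧ ∃ g : ℝ, 0 < g ∧ g < 1 ∧ s.ρ = SP[lo, K, g] ∧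
      2 * (lo : ℝ) ≤ s.q * ((lo : ℝ) + K * g) ∧ x ≤ s.q * g) :
    SDEC x (ftop L) (flaw L) := by
  by_cases hnil : L = []
  · subst hnil; intro q _ _ j' hj'; exact absurd hj' (Nat.not_lt_zero _)
  · obtain ⟨s, hs⟩ := List.exists_mem_of_ne_nil L hnil
    have hx1 : x < 1 := by
      obtain ⟨_, hq0, hq1, g, hg0, hg1, _, _, hxg⟩ := hL s hs
      nlinarith
    have hLaw : ∀ s ∈ L, s.LawOK := by
      intro s hs
      obtain ⟨hM, hq0, hq1, g, hg0, hg1, hρ, _, _⟩ := hL s hs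
      obtain ⟨c0, cM, c1, _⟩ := sp_laws lo K hg0.le hg1.le
      refine ⟨hq0, hq1, ?_, ?_, ?_⟩
      · intro h; rw [hρ]; exact c0 h
      · intro h hh; rw [hρ]; exact cM h (by rw [hM] at hh; exact hh)
      · rw [hM, hρ]; exact c1
    obtain ⟨_, fM, _, _⟩ := flaw_facts L hLaw
    have h := (shapeForest_inv_long lo K hloK hK4 hx0 hx1 L hL [] (fun γ h => by simp at h) (by simpa using hL3)).2.1 (Or.inl (by simp))
    have e : lconv ((lo + K) * ([] : List ℝ).length) (ftop L) (sHub lo K []) (flaw L) = flaw L := funext fun k => lconv_delta_left _ _ _ fM k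
    rw [e] at h
    simpa using h

/-! ### Any parameters: light glued siblings are tame -/

/-- law / floor / tameness facts of a glued sibling `⟨q,·,·,lo+K,S(g)⟩` of ANY shape with `0 < q, g < 1`, `x ≤ qg`, `1 ≤ lo`: it is `LawOK`, affordable
(`x(lo+K) ≤ q·mean`), and if LIGHT (`q·mean < 2lo`) then tame (`q·mean ≤ 2h` at each of its atoms `h ∈ {lo, lo+K}`). [this work] -/
theorem shapeSib_facts (lo K : ℕ) (hlo : 1 ≤ lo) {x : ℝ} (s : Sib)
    (hs : s.M = lo + K ∧ 0 < s.q ∧ s.q < 1 ∧ ∃ g : ℝ, 0 < g ∧ g < 1 ∧ s.ρ = SP[lo, K, g] ∧ x ≤ s.q * g) :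
    s.LawOK ∧ x * (s.M : ℝ) ≤ s.q * s.mean ∧
      (∀ h : ℕ, 1 ≤ h → s.ρ h ≠ 0 → s.q * s.mean < 2 * lo → s.q * s.mean ≤ 2 * h) := by
  obtain ⟨hM, hq0, hq1, g, hg0, hg1, hρ, hx⟩ := hs
  obtain ⟨c0, cM, c1, cm⟩ := sp_laws lo K hg0.le hg1.le
  have hmean : s.mean = (lo : ℝ) + K * g := by unfold Sib.mean; rw [hM, hρ]; exact cm
  refine ⟨⟨hq0, hq1, fun h => by rw [hρ]; exact c0 h, fun h hh => by rw [hρ]; exact cM h (by rw [hM] at hh; exact hh),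
    by rw [hM, hρ]; exact c1⟩, ?_, ?_⟩
  · rw [hM, hmean]; push_cast
    have hB : (0 : ℝ) ≤ (lo : ℝ) + K := by positivity
    have h1 := mul_le_mul_of_nonneg_right hx hB
    have h2 : 0 ≤ s.q * (lo : ℝ) * (1 - g) := mul_nonneg (mul_nonneg hq0.le (Nat.cast_nonneg lo)) (by linarith)
    nlinarith
  · intro h _ hh hlt
    have hat : h = lo ∨ h = lo + K := by
      by_contra hc
      push Not at hc
      apply hh; rw [hρ]; dsimp only; rw [if_neg hc.1, if_neg hc.2]; ring
    have : (lo : ℝ) ≤ h := by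
      rcases hat with rfl | rfl
      · exact le_rfl
      · push_cast; linarith [(Nat.cast_nonneg K : (0 : ℝ) ≤ K)]
    linarith

/-- **AT MOST THREE HEAVY GLUED SIBLINGS OF ONE SHAPE `lo < K ≤ 4lo` PLUS ANY NUMBER OF LIGHT ONES ARE SDEC AT EVERY TREE-OK FLOOR.**  `Lh`: `≤ 3`
siblings `⟨q,·,·,lo+K,S(g)⟩` with `q(lo+Kg) ≥ 2lo`; `Lt`: any list of siblings of the same shape with `q(lo+Kg) < 2lo` (tame, arm-1 g57's
`sdec_cons_of_tame` / `sdec_append_tame`); all with `0 < q, g < 1`, `x ≤ qg`; `0 < x` ⟹ `SDEC x (ftop (Lt ++ Lh)) (flaw (Lt ++ Lh))` (any order by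
`sdec_flaw_perm`). [this work] -/
theorem sdec_shapeForest_long_append (lo K : ℕ) (hloK : lo < K) (hK4 : K ≤ 4 * lo) {x : ℝ} (hx0 : 0 < x) (Lh Lt : List Sib)
    (hLh3 : Lh.length ≤ 3)
    (hLh : ∀ s ∈ Lh, s.M = lo + K ∧ 0 < s.q ∧ s.q < 1 ∧ ∃ g : ℝ, 0 < g ∧ g < 1 ∧ s.ρ = SP[lo, K, g] ∧
      2 * (lo : ℝ) ≤ s.q * ((lo : ℝ) + K * g) ∧ x ≤ s.q * g)
    (hLt : ∀ s ∈ Lt, s.M = lo + K ∧ 0 < s.q ∧ s.q < 1 ∧ ∃ g : ℝ, 0 < g ∧ g < 1 ∧ s.ρ = SP[lo, K, g] ∧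
      s.q * ((lo : ℝ) + K * g) < 2 * lo ∧ x ≤ s.q * g) :
    SDEC x (ftop (Lt ++ Lh)) (flaw (Lt ++ Lh)) := by
  by_cases hnil : Lt ++ Lh = []
  · rw [hnil]; intro q _ _ j' hj'; exact absurd hj' (Nat.not_lt_zero _)
  obtain ⟨s₀, hs₀⟩ := List.exists_mem_of_ne_nil _ hnil
  have hx1 : x < 1 := by
    rcases List.mem_append.1 hs₀ with h | h
    · obtain ⟨_, hq0, hq1, g, hg0, hg1, _, _, hx⟩ := hLt s₀ h
      nlinarith
    · obtain ⟨_, hq0, hq1, g, hg0, hg1, _, _, hx⟩ := hLh s₀ h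
      nlinarith
  have hlo : 1 ≤ lo := by omega
  have fh : ∀ s ∈ Lh, s.LawOK ∧ x * (s.M : ℝ) ≤ s.q * s.mean ∧
      (∀ h : ℕ, 1 ≤ h → s.ρ h ≠ 0 → s.q * s.mean < 2 * lo → s.q * s.mean ≤ 2 * h) := by
    intro s hs
    obtain ⟨hM, hq0, hq1, g, hg0, hg1, hρ, _, hx⟩ := hLh s hs
    exact shapeSib_facts lo K hlo s ⟨hM, hq0, hq1, g, hg0, hg1, hρ, hx⟩
  have ft : ∀ s ∈ Lt, s.LawOK ∧ x * (s.M : ℝ) ≤ s.q * s.mean ∧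
      (∀ h : ℕ, 1 ≤ h → s.ρ h ≠ 0 → s.q * s.mean < 2 * lo → s.q * s.mean ≤ 2 * h) := by
    intro s hs
    obtain ⟨hM, hq0, hq1, g, hg0, hg1, hρ, _, hx⟩ := hLt s hs
    exact shapeSib_facts lo K hlo s ⟨hM, hq0, hq1, g, hg0, hg1, hρ, hx⟩
  have hSh : SDEC x (ftop Lh) (flaw Lh) := sdec_shapeForest_long lo K hloK hK4 hx0 Lh hLh3 hLh
  refine sdec_append_tame hx0 hx1 Lh (fun t ht => (fh t ht).1) (fun t ht => (fh t ht).2.1) hSh Lt (fun s hs => (ft s hs).1)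
    (fun s hs => (ft s hs).2.1) ?_
  intro s hs h h1 hh
  have hlt : s.q * s.mean < 2 * lo := by
    obtain ⟨hM, _, _, g, hg0, hg1, hρ, hlt, _⟩ := hLt s hs
    obtain ⟨_, _, _, cm⟩ := sp_laws lo K hg0.le hg1.le
    have hmean : s.mean = (lo : ℝ) + K * g := by unfold Sib.mean; rw [hM, hρ]; exact cm
    rw [hmean]; exact hlt
  exact Or.inl ((ft s hs).2.2 h h1 hh hlt)

/-- **EVERY FOREST OF AT MOST THREE GLUED SIBLINGS `R^lo(R^K)` OF ONE SHAPE `lo < K ≤ 4lo` IS SDEC AT EVERY TREE-OK FLOOR — ANY PARAMETERS, NO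
ORACLE.**  For every list `L` of `≤ 3` siblings `⟨q,·,·,lo+K,{lo: 1−g, lo+K: g}⟩` with `0 < q, g < 1` and every floor `0 < x ≤ min qᵢgᵢ`:
`SDEC x (ftop L) (flaw L)`.  Heavy siblings (`q(lo+Kg) ≥ 2lo`) by the expansion `sdec_shapeForest_long`, light ones are tame (`sdec_append_tame`).
(g32's `sdec_shapeForests_all_twoLo`: `K ≤ 2lo`, every width; census-2 g80's `sdec_gluedThree_trueFloor`: identical gates.) [this work] -/
theorem sdec_shapeForests_three_long (lo K : ℕ) (hloK : lo < K) (hK4 : K ≤ 4 * lo) {x : ℝ} (hx0 : 0 < x) (L : List Sib) (hL3 : L.length ≤ 3)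
    (hL : ∀ s ∈ L, s.M = lo + K ∧ 0 < s.q ∧ s.q < 1 ∧ ∃ g : ℝ, 0 < g ∧ g < 1 ∧ s.ρ = SP[lo, K, g] ∧ x ≤ s.q * g) :
    SDEC x (ftop L) (flaw L) := by
  classical
  have hsplit : ∀ s ∈ L, ∃ g : ℝ, s.M = lo + K ∧ 0 < s.q ∧ s.q < 1 ∧ 0 < g ∧ g < 1 ∧ s.ρ = SP[lo, K, g] ∧ x ≤ s.q * g ∧
      s.mean = (lo : ℝ) + K * g := by
    intro s hs
    obtain ⟨hM, hq0, hq1, g, hg0, hg1, hρ, hx⟩ := hL s hs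
    obtain ⟨_, _, _, cm⟩ := sp_laws lo K hg0.le hg1.le
    exact ⟨g, hM, hq0, hq1, hg0, hg1, hρ, hx, by unfold Sib.mean; rw [hM, hρ]; exact cm⟩
  set b : Sib → Bool := fun s => decide (2 * (lo : ℝ) ≤ s.q * s.mean) with hb
  set Lh := L.filter b with hLh
  set Lt := L.filter (fun s => !b s) with hLt
  have hperm : (Lt ++ Lh).Perm L := (List.perm_append_comm).trans (List.filter_append_perm b L)
  refine sdec_flaw_perm hperm ?_
  refine sdec_shapeForest_long_append lo K hloK hK4 hx0 Lh Lt ((List.length_filter_le _ _).trans hL3) ?_ ?_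
  · intro s hs
    have hbs : 2 * (lo : ℝ) ≤ s.q * s.mean := by
      have := (List.mem_filter.1 hs).2
      simpa [hb] using this
    obtain ⟨g, hM, hq0, hq1, hg0, hg1, hρ, hx, hmean⟩ := hsplit s (List.mem_of_mem_filter hs)
    exact ⟨hM, hq0, hq1, g, hg0, hg1, hρ, by rw [← hmean]; exact hbs, hx⟩
  · intro s hs
    have hbs : s.q * s.mean < 2 * lo := by
      have := (List.mem_filter.1 hs).2
      simp [hb] at this
      exact this
    obtain ⟨g, hM, hq0, hq1, hg0, hg1, hρ, hx, hmean⟩ := hsplit s (List.mem_of_mem_filter hs)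
    exact ⟨hM, hq0, hq1, g, hg0, hg1, hρ, by rw [← hmean]; exact hbs, hx⟩

end LawDec
end Quant
end Summit.CriticalPhenomena.PercolationContinuityZ3.Theorems
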